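import Summits.FinalStateConjecture.FinalStateConjecture.Theorems.PhotonSphereChannelsExteriorEnergyRW

/-!
# Route PhotonSphereChannels — tools for the fixed-mode Morawetz estimate: energy slices, vanishing outside
# the cone, bumps, pointwise absorption inequalities, space-time integral bookkeeping

Helper file for the registered sub-goal `stub_rwLocalEnergyDecay` (integrated local energy decay) of stub
`stub_outgoingEnergyExhaustion` (H4) of line `isolated-kerr-connected-hull` (crux stmt-FinalStateConjecture-14075),
over the Literature vocabulary `ReggeWheeler.{energyDensity, IsSolution, totalEnergy, CauchyDataSupportedOn}`:
* `RW.integral_energy_le_initial` (= registered summary `stub_rwEnergySliceBound`): for a global `C²` solution of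
  `ψ_tt − ψ_xx + Vψ = 0` (`V ≥ 0` differentiable) with Cauchy data supported in `(a, b)`, every energy slice
  `∫_A^B e(t,·)` is bounded by the (finite, conserved) initial energy `∫_a^b e(0,·)`;
* `RW.eq_zero_outside_cone`: the solution AND its first partials vanish outside the light cone of the data;
* `RW.exists_bump`: a `C¹` bump (`ContDiffBump`) with its derivative, both vanishing off a compact interval;
* `RW.exists_pos_le_on_Icc`, `RW.exists_abs_le_on_Icc`: compactness constants;
* `RW.bulk_absorb`, `RW.bulk_absorb_off`, `RW.morawetzP_abs_le`, `RW.lagrangeP_abs_le`: the pure real-arithmetic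
  pointwise inequalities by which the Lagrangian current of the bump is absorbed into `c`·(coercive Morawetz
  bulk) and both currents are bounded by the energy density;
* `RW.integral2_mono_of_nonneg`, `RW.abs_integral_slice_le`: monotonicity bookkeeping for the iterated interval
  integrals `∫_0^T ∫_p^q`.
No new definitions; standard material [folklore].
-/

namespace Summit.FinalStateConjecture.FinalStateConjecture.Theorems

-- every `Summit.FinalStateConjecture.FinalStateConjecture.…` name repeats the summit = sub-problem
-- segment (D-0017 layout), as in every landed `…Theorems` file of this route
set_option linter.dupNamespace false

open MeasureTheory Set Filter Topology intervalIntegral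
open Literature.Geometry.Lorentzian Literature.Geometry.Lorentzian.ReggeWheeler

noncomputable section

namespace RW

/-! ### Elementary tools: compactness constants, a bump, energy slices, vanishing outside the cone -/

section Tools

/-- A continuous positive function is bounded below by a positive constant on a compact interval. -/
theorem exists_pos_le_on_Icc {g : ℝ → ℝ} (hg : Continuous g) (hpos : ∀ x, 0 < g x) {p q : ℝ}
    (hpq : p ≤ q) : ∃ c : ℝ, 0 < c ∧ ∀ x ∈ Icc p q, c ≤ g x := by
  obtain ⟨x₀, _, hx₀⟩ := (isCompact_Icc (a := p) (b := q)).exists_isMinOn (nonempty_Icc.2 hpq)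
    hg.continuousOn
  exact ⟨g x₀, hpos x₀, fun x hx => hx₀ hx⟩

/-- A continuous function is bounded in absolute value by a non-negative constant on a compact interval. -/
theorem exists_abs_le_on_Icc {g : ℝ → ℝ} (hg : Continuous g) (p q : ℝ) :
    ∃ C : ℝ, 0 ≤ C ∧ ∀ x ∈ Icc p q, |g x| ≤ C := by
  obtain ⟨C, hC⟩ := (isCompact_Icc (a := p) (b := q)).exists_bound_of_continuousOn hg.continuousOn
  refine ⟨max C 0, le_max_right _ _, fun x hx => ?_⟩
  have := hC x hx
  rw [Real.norm_eq_abs] at this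
  exact this.trans (le_max_left _ _)

/-- A `C¹` bump adapted to `[xc − ρ, xc + ρ]`: equal to `1` there, supported in `[xc − ρ − 1, xc + ρ + 1]`
(together with its derivative), with values in `[0, 1]`. -/
theorem exists_bump (xc : ℝ) {ρ : ℝ} (hρ : 0 < ρ) :
    ∃ h h' : ℝ → ℝ, (∀ x, HasDerivAt h (h' x) x) ∧ Continuous h' ∧ (∀ x, 0 ≤ h x ∧ h x ≤ 1) ∧
      (∀ x, |x - xc| ≤ ρ → h x = 1) ∧ (∀ x, ρ + 1 < |x - xc| → h x = 0 ∧ h' x = 0) := by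
  let b : ContDiffBump xc := ⟨ρ, ρ + 1, hρ, by linarith⟩
  have hcd : ContDiff ℝ 1 (b : ℝ → ℝ) := b.contDiff
  have hd : Differentiable ℝ (b : ℝ → ℝ) := hcd.differentiable one_ne_zero
  refine ⟨b, deriv b, fun x => (hd x).hasDerivAt, hcd.continuous_deriv le_rfl,
    fun x => ⟨b.nonneg, b.le_one⟩, fun x hx => ?_, fun x hx => ?_⟩
  · exact b.one_of_mem_closedBall (by simpa [Metric.mem_closedBall, Real.dist_eq] using hx)
  · have hopen : IsOpen {y : ℝ | ρ + 1 < |y - xc|} :=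
      isOpen_lt continuous_const (continuous_abs.comp (continuous_id.sub continuous_const))
    have hzero : ∀ y ∈ {y : ℝ | ρ + 1 < |y - xc|}, (b : ℝ → ℝ) y = 0 := fun y hy =>
      b.zero_of_le_dist (by rw [Real.dist_eq]; exact le_of_lt hy)
    refine ⟨hzero x hx, ?_⟩
    have hev : (b : ℝ → ℝ) =ᶠ[𝓝 x] fun _ => (0 : ℝ) :=
      Filter.eventuallyEq_of_mem (hopen.mem_nhds hx) hzero
    rw [hev.deriv_eq]
    exact deriv_const x 0

variable {V : ℝ → ℝ} {ψ : ℝ → ℝ → ℝ}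

/-- Dictionary: the Literature energy density of a `C²` function in Fréchet form (private copy of
`RW.energyDensity_eq_fderiv` of `…RTotalEnergyConservation`, not importable together with this file's
dependencies at the time of writing). -/
private theorem energyDensity_eq_fderiv' (hψ : ContDiff ℝ 2 (Function.uncurry ψ)) (t x : ℝ) :
    energyDensity V ψ t x = (fderiv ℝ (Function.uncurry ψ) (t, x) (1, 0)) ^ 2
      + (fderiv ℝ (Function.uncurry ψ) (t, x) (0, 1)) ^ 2 + V x * Function.uncurry ψ (t, x) ^ 2 := by
  unfold energyDensity
  rw [WaveEnergy.deriv_slice_fst_eq hψ, WaveEnergy.deriv_slice_snd_eq hψ]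
  rfl

/-- Dictionary: a global solution solves the equation in Fréchet form (private copy of
`RW.IsSolution.fderiv_eq`). -/
private theorem isSolution_fderiv_eq' (hψ : IsSolution V ψ) :
    ∀ z : ℝ × ℝ, fderiv ℝ (fderiv ℝ (Function.uncurry ψ)) z (1, 0) (1, 0)
      - fderiv ℝ (fderiv ℝ (Function.uncurry ψ)) z (0, 1) (0, 1) + V z.2 * Function.uncurry ψ z = 0 := by
  rintro ⟨t, x⟩
  rw [← WaveEnergy.iteratedDeriv_two_slice_fst_eq hψ.1, ← WaveEnergy.iteratedDeriv_two_slice_snd_eq hψ.1]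
  exact hψ.2 (t, x)

/-- **Energy slices are bounded by the initial energy.** For a global `C²` solution (`V ≥ 0` differentiable)
with Cauchy data supported in `(a, b)`, `a ≤ b`: the total energy is `ofReal E₀` with
`E₀ = ∫_a^b e(0,·) ≥ 0`, and `∫_A^B e(t,·) ≤ E₀` for every `t` and `A ≤ B`. [folklore] -/
theorem integral_energy_le_initial (hV : Differentiable ℝ V) (hV0 : ∀ x, 0 ≤ V x) (hψ : IsSolution V ψ)
    {a b : ℝ} (hab : a ≤ b) (hdata : CauchyDataSupportedOn ψ (Ioo a b)) :
    0 ≤ (∫ x in a..b, energyDensity V ψ 0 x) ∧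
      totalEnergy V ψ 0 = ENNReal.ofReal (∫ x in a..b, energyDensity V ψ 0 x) ∧
      ∀ t A B : ℝ, A ≤ B → (∫ x in A..B, energyDensity V ψ t x) ≤ ∫ x in a..b, energyDensity V ψ 0 x := by
  have hc : ∀ t, Continuous fun x => energyDensity V ψ t x := fun t =>
    (WaveEnergy.continuous_energyDensity hψ.1 hV (fun z => energyDensity_eq_fderiv' hψ.1 z.1 z.2)).comp
      (Continuous.prodMk_right t)
  have hnn : ∀ t x, 0 ≤ energyDensity V ψ t x := fun t x => energyDensity_nonneg ψ t (hV0 x)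
  have hE0 : 0 ≤ ∫ x in a..b, energyDensity V ψ 0 x :=
    intervalIntegral.integral_nonneg hab fun x _ => hnn 0 x
  refine ⟨hE0, totalEnergy_eq hV hV0 hψ hab hdata 0, fun t A B hAB => ?_⟩
  have h1 := WaveEnergy.lintegral_Ioc_eq_ofReal_intervalIntegral (hc t) (hnn t) hAB
  have h2 : ∫⁻ x in Ioc A B, ENNReal.ofReal (energyDensity V ψ t x) ≤ totalEnergy V ψ t :=
    setLIntegral_le_lintegral _ _
  rw [h1, totalEnergy_eq hV hV0 hψ hab hdata t] at h2
  exact (ENNReal.ofReal_le_ofReal_iff hE0).1 h2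

/-- Outside the light cone of data supported in `(a, b)` the solution and its first partials vanish:
at every `(t, y)` with `b + |t| ≤ y` or `y ≤ a − |t|`. [folklore] -/
theorem eq_zero_outside_cone (hV : Differentiable ℝ V) (hV0 : ∀ x, 0 ≤ V x) (hψ : IsSolution V ψ)
    {a b : ℝ} (hdata : CauchyDataSupportedOn ψ (Ioo a b)) {t y : ℝ} (hy : b + |t| ≤ y ∨ y ≤ a - |t|)
    (v : ℝ × ℝ) : Function.uncurry ψ (t, y) = 0 ∧ fderiv ℝ (Function.uncurry ψ) (t, y) v = 0 := by
  have hd := cauchyDataSupportedOn_Ioo.1 hdata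
  have hd0 : ∀ y, y ≤ a ∨ b ≤ y → Function.uncurry ψ (0, y) = 0 := fun y hy => (hd y hy).1
  have hd1 : ∀ y, y ≤ a ∨ b ≤ y → fderiv ℝ (Function.uncurry ψ) (0, y) (1, 0) = 0 := fun y hy => by
    rw [← WaveEnergy.deriv_slice_fst_eq hψ.1]
    exact (hd y hy).2
  rcases hy with hy | hy
  · exact WaveEnergy.eq_zero_right_of_data hψ.1 hV hV0 (isSolution_fderiv_eq' hψ) (c := b)
      (fun y hy => hd0 y (Or.inr hy)) (fun y hy => hd1 y (Or.inr hy)) hy v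
  · exact WaveEnergy.eq_zero_left_of_data hψ.1 hV hV0 (isSolution_fderiv_eq' hψ) (c := a)
      (fun y hy => hd0 y (Or.inl hy)) (fun y hy => hd1 y (Or.inl hy)) hy v

end Tools

/-! ### Pointwise inequalities (pure real arithmetic) -/

section Pointwise

/-- On the support of the bump: the Lagrangian terms are absorbed by `N/m₁ · m (p² + q²)`. -/
theorem bulk_absorb {c m₁ mx hx h'x Vx Hb Vb Q₀ p q w : ℝ} (hc : c = (1 + Hb + Vb + 1) / m₁)
    (hm₁ : 0 < m₁) (hmx : m₁ ≤ mx) (hHb : 0 ≤ Hb) (hVb0 : 0 ≤ Vb) (hh0 : 0 ≤ hx) (hh1 : hx ≤ 1)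
    (hh' : |h'x| ≤ Hb) (hVb : Vx ≤ Vb) (hQ : mx * (p ^ 2 + q ^ 2) ≤ Q₀) :
    hx * w ^ 2 + 1 / m₁ * mx * (p ^ 2 + q ^ 2)
      ≤ c * Q₀ + (hx * w ^ 2 - hx * p ^ 2 - h'x * (q * p) - hx * Vx * q ^ 2) := by
  subst hc
  have h1 : hx * p ^ 2 ≤ p ^ 2 := by nlinarith [sq_nonneg p]
  have h2 : h'x * (q * p) ≤ Hb * (p ^ 2 + q ^ 2) := by
    have ha : |h'x * (q * p)| ≤ Hb * (p ^ 2 + q ^ 2) := by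
      rw [abs_mul]
      refine (mul_le_mul_of_nonneg_right hh' (abs_nonneg _)).trans (mul_le_mul_of_nonneg_left ?_ hHb)
      rw [abs_mul]
      nlinarith [sq_nonneg (|q| - |p|), sq_abs q, sq_abs p]
    linarith [le_abs_self (h'x * (q * p))]
  have h3 : hx * Vx * q ^ 2 ≤ Vb * q ^ 2 := by
    refine mul_le_mul_of_nonneg_right ?_ (sq_nonneg q)
    nlinarith
  have h4 : (1 + Hb + Vb) * (p ^ 2 + q ^ 2) ≤ (1 + Hb + Vb) / m₁ * (mx * (p ^ 2 + q ^ 2)) := by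
    have e2 : (1 + Hb + Vb) * (p ^ 2 + q ^ 2) = (1 + Hb + Vb) / m₁ * (m₁ * (p ^ 2 + q ^ 2)) := by
      field_simp
    rw [e2]
    exact mul_le_mul_of_nonneg_left (mul_le_mul_of_nonneg_right hmx (by positivity)) (by positivity)
  have h5 : (1 + Hb + Vb + 1) / m₁ * (mx * (p ^ 2 + q ^ 2)) ≤ (1 + Hb + Vb + 1) / m₁ * Q₀ :=
    mul_le_mul_of_nonneg_left hQ (by positivity)
  have e1 : (1 + Hb + Vb + 1) / m₁ * (mx * (p ^ 2 + q ^ 2))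
      = 1 / m₁ * mx * (p ^ 2 + q ^ 2) + (1 + Hb + Vb) / m₁ * (mx * (p ^ 2 + q ^ 2)) := by ring
  have h6 : 0 ≤ Vb * p ^ 2 := by positivity
  nlinarith [sq_nonneg q, sq_nonneg p]

/-- Off the support of the bump: `m/m₁ (p² + q²) ≤ c · Q₀`. -/
theorem bulk_absorb_off {c m₁ mx Hb Vb Q₀ p q : ℝ} (hc : c = (1 + Hb + Vb + 1) / m₁) (hm₁ : 0 < m₁)
    (hHb : 0 ≤ Hb) (hVb0 : 0 ≤ Vb) (hmx : 0 ≤ mx) (hQ : mx * (p ^ 2 + q ^ 2) ≤ Q₀) :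
    1 / m₁ * mx * (p ^ 2 + q ^ 2) ≤ c * Q₀ := by
  subst hc
  have h5 : (1 + Hb + Vb + 1) / m₁ * (mx * (p ^ 2 + q ^ 2)) ≤ (1 + Hb + Vb + 1) / m₁ * Q₀ :=
    mul_le_mul_of_nonneg_left hQ (by positivity)
  have e1 : (1 + Hb + Vb + 1) / m₁ * (mx * (p ^ 2 + q ^ 2))
      = 1 / m₁ * mx * (p ^ 2 + q ^ 2) + (1 + Hb + Vb) / m₁ * (mx * (p ^ 2 + q ^ 2)) := by ring
  have h6 : 0 ≤ (1 + Hb + Vb) / m₁ * (mx * (p ^ 2 + q ^ 2)) := by positivity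
  linarith

/-- The Morawetz current is bounded by the energy density: `|w (f p + ½ f′ q)| ≤ w² + p² + V q²` when
`|f| ≤ 1`, `f′² ≤ (9/16) V`. -/
theorem morawetzP_abs_le {fx f'x Vx w p q : ℝ} (hf : |fx| ≤ 1) (hf' : f'x ^ 2 ≤ 9 / 16 * Vx)
    (hV : 0 ≤ Vx) : |w * (fx * p + 1 / 2 * f'x * q)| ≤ w ^ 2 + p ^ 2 + Vx * q ^ 2 := by
  have hf2 : fx ^ 2 ≤ 1 := by
    rw [abs_le] at hf
    nlinarith
  have hfp : fx ^ 2 * p ^ 2 ≤ p ^ 2 := by nlinarith [sq_nonneg p]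
  have hf'q : f'x ^ 2 * q ^ 2 ≤ 9 / 16 * Vx * q ^ 2 := by nlinarith [sq_nonneg q]
  have hVq : 0 ≤ Vx * q ^ 2 := by positivity
  rw [abs_le]
  constructor
  · nlinarith [sq_nonneg (w + fx * p), sq_nonneg (w + 1 / 2 * f'x * q)]
  · nlinarith [sq_nonneg (w - fx * p), sq_nonneg (w - 1 / 2 * f'x * q)]

/-- The Lagrangian current of the bump is bounded by the energy density on the support:
`|h w q| ≤ (1 + 1/V₁)(w² + p² + V q²)` when `0 ≤ h ≤ 1`, `V ≥ V₁ > 0`. -/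
theorem lagrangeP_abs_le {V₁ Vx hx w p q : ℝ} (hV₁ : 0 < V₁) (hVx : V₁ ≤ Vx) (hh0 : 0 ≤ hx)
    (hh1 : hx ≤ 1) : |hx * w * q| ≤ (1 + 1 / V₁) * (w ^ 2 + p ^ 2 + Vx * q ^ 2) := by
  have hq2 : q ^ 2 ≤ 1 / V₁ * (Vx * q ^ 2) := by
    rw [one_div, ← div_eq_inv_mul, le_div_iff₀ hV₁]
    nlinarith [sq_nonneg q]
  have h1 : |hx * w * q| ≤ |w| * |q| := by
    rw [abs_mul, abs_mul, abs_of_nonneg hh0]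
    nlinarith [mul_nonneg (abs_nonneg w) (abs_nonneg q)]
  have h2 : |w| * |q| ≤ (w ^ 2 + q ^ 2) / 2 := by nlinarith [sq_nonneg (|w| - |q|), sq_abs w, sq_abs q]
  have h3 : 0 ≤ 1 / V₁ * (w ^ 2 + p ^ 2) := by positivity
  have h4 : 0 ≤ Vx * q ^ 2 := by nlinarith [sq_nonneg q]
  have e : (1 + 1 / V₁) * (w ^ 2 + p ^ 2 + Vx * q ^ 2)
      = w ^ 2 + p ^ 2 + Vx * q ^ 2 + 1 / V₁ * (w ^ 2 + p ^ 2) + 1 / V₁ * (Vx * q ^ 2) := by ring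
  nlinarith [sq_nonneg p, sq_nonneg w]

end Pointwise

/-! ### Integral bookkeeping -/

section Integrals

/-- Parametric interval integrals of a continuous function on `ℝ × ℝ` are continuous in the parameter. -/
theorem continuous_intervalIntegral_slice {G : ℝ × ℝ → ℝ} (hG : Continuous G) (A B : ℝ) :
    Continuous fun t => ∫ x in A..B, G (t, x) := by
  have h : Continuous (Function.uncurry fun t x => G (t, x)) :=
    hG.comp (continuous_fst.prodMk continuous_snd)
  exact intervalIntegral.continuous_parametric_intervalIntegral_of_continuous' h A B

/-- Space-time monotonicity: if `D ≤ B` on the strip `[0,T] × [p,q]` and `B ≥ 0` everywhere, then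
`∫_0^T ∫_p^q D ≤ ∫_0^T ∫_{X_L}^{X_R} B` for `X_L ≤ p ≤ q ≤ X_R` (continuous densities). -/
theorem integral2_mono_of_nonneg {D B : ℝ × ℝ → ℝ} (hD : Continuous D) (hB : Continuous B)
    {T p q XL XR : ℝ} (hT : 0 ≤ T) (h1 : XL ≤ p) (hpq : p ≤ q) (h2 : q ≤ XR)
    (hle : ∀ t ∈ Icc 0 T, ∀ x ∈ Icc p q, D (t, x) ≤ B (t, x)) (hB0 : ∀ z, 0 ≤ B z) :
    (∫ t in (0:ℝ)..T, ∫ x in p..q, D (t, x)) ≤ ∫ t in (0:ℝ)..T, ∫ x in XL..XR, B (t, x) := by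
  have hiD : ∀ t, IntervalIntegrable (fun x => D (t, x)) volume p q := fun t =>
    (hD.comp (Continuous.prodMk_right t)).intervalIntegrable _ _
  have hiB : ∀ t a b, IntervalIntegrable (fun x => B (t, x)) volume a b := fun t a b =>
    (hB.comp (Continuous.prodMk_right t)).intervalIntegrable _ _
  refine intervalIntegral.integral_mono_on hT
    ((continuous_intervalIntegral_slice hD _ _).intervalIntegrable _ _)
    ((continuous_intervalIntegral_slice hB _ _).intervalIntegrable _ _) fun t ht => ?_
  calc (∫ x in p..q, D (t, x)) ≤ ∫ x in p..q, B (t, x) :=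
        intervalIntegral.integral_mono_on hpq (hiD t) (hiB t _ _) fun x hx => hle t ht x hx
    _ ≤ ∫ x in XL..XR, B (t, x) :=
        intervalIntegral.integral_mono_interval h1 hpq h2
          (Filter.Eventually.of_forall fun x => hB0 (t, x)) (hiB t _ _)

/-- Time-slice bound: `|P| ≤ K e` pointwise and `∫ e ≤ E₀` give `|∫ P| ≤ K E₀`. -/
theorem abs_integral_slice_le {P e : ℝ × ℝ → ℝ} (hP : Continuous P) (he : Continuous e) {K E₀ XL XR : ℝ}
    (hK : 0 ≤ K) (hXLR : XL ≤ XR) (t : ℝ) (hPe : ∀ x, |P (t, x)| ≤ K * e (t, x))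
    (hE : (∫ x in XL..XR, e (t, x)) ≤ E₀) :
    (∫ x in XL..XR, P (t, x)) ≤ K * E₀ ∧ -(∫ x in XL..XR, P (t, x)) ≤ K * E₀ := by
  have hiP : IntervalIntegrable (fun x => P (t, x)) volume XL XR :=
    (hP.comp (Continuous.prodMk_right t)).intervalIntegrable _ _
  have hie : IntervalIntegrable (fun x => K * e (t, x)) volume XL XR :=
    ((continuous_const.mul he).comp (Continuous.prodMk_right t)).intervalIntegrable _ _
  have hEt : (∫ x in XL..XR, K * e (t, x)) ≤ K * E₀ := by
    rw [intervalIntegral.integral_const_mul]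
    exact mul_le_mul_of_nonneg_left hE hK
  constructor
  · exact (intervalIntegral.integral_mono_on hXLR hiP hie fun x _ => (abs_le.1 (hPe x)).2).trans hEt
  · rw [← intervalIntegral.integral_neg]
    have hiP' : IntervalIntegrable (fun x => -P (t, x)) volume XL XR := hiP.neg
    refine (intervalIntegral.integral_mono_on hXLR hiP' hie fun x _ => ?_).trans hEt
    have := (abs_le.1 (hPe x)).1
    linarith

end Integrals


/-- **Registered sub-goal `stub_rwEnergySliceBound` of `stub_rwLocalEnergyDecay`** (crux
stmt-FinalStateConjecture-14075, line `isolated-kerr-connected-hull`): energy slices of a global `C²` solution with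
compactly supported Cauchy data are bounded by the finite, conserved initial energy. [folklore] -/
theorem stub_rwEnergySliceBound :
    ∀ (V : ℝ → ℝ) (ψ : ℝ → ℝ → ℝ) (a b : ℝ), Differentiable ℝ V → (∀ x, 0 ≤ V x) →
      ReggeWheeler.IsSolution V ψ → a ≤ b → ReggeWheeler.CauchyDataSupportedOn ψ (Set.Ioo a b) →
        0 ≤ (∫ x in a..b, ReggeWheeler.energyDensity V ψ 0 x) ∧
        ReggeWheeler.totalEnergy V ψ 0 = ENNReal.ofReal (∫ x in a..b, ReggeWheeler.energyDensity V ψ 0 x) ∧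
        ∀ t A B : ℝ, A ≤ B → (∫ x in A..B, ReggeWheeler.energyDensity V ψ t x)
          ≤ ∫ x in a..b, ReggeWheeler.energyDensity V ψ 0 x :=
  fun _ _ _ _ hV hV0 hψ hab hdata => integral_energy_le_initial hV hV0 hψ hab hdata

end RW

end

end Summit.FinalStateConjecture.FinalStateConjecture.Theorems
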